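import Literature.AlgebraicGeometry.Motives.Jacobian
import Literature.AlgebraicGeometry.Motives.SeparatedQuotient
import Literature.AlgebraicGeometry.Motives.AlgPointsNonempty
import HarnessLib

/-!
# The norm map of a Galois cover of curves: `Nm_Δ ∘ … `, right-cancellation of `Nm_p`, and `Nm_p ∘ p^* = |Δ|`
# (Lange–Rodríguez 2022, §3.2.1 and Prop. 3.5.1; Lange 2023, §4.5.2)

Layer `Literature/AlgebraicGeometry/Motives`, namespace `Literature.AlgebraicGeometry.Motives.Jacobian`.  THEOREMS ONLY over the
tree's Albanese-characterised `Motives.Jacobian` (`Jacobian.pushforward` = the norm map `Nm_f = f_*`) and the quotient predicate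
`IsSepQuotient` (`Motives/SeparatedQuotient`); no definition, no named fact, no instance, no `sorry`.

THE PRINT.  H. Lange, R. E. Rodríguez, *Decomposition of Jacobians by Prym Varieties* (2022), §3.2.1 pp. 46–47: «the norm map
`Nm_f : J̃ → J`. The definitions immediately give `Nm_f ∘ f^* = d_J`»; §3.5.1 p. 65, Prop. 3.5.1: «For any Galois cover
`f : C̃ → C` with group `G`, we have `Nm_G = f^* ∘ Nm_f`», `Nm_G(x) = Σ_{σ ∈ G} σ(x)`.  H. Lange, *Abelian Varieties over the Complex
Numbers* (2023), §4.5.2: `N_f` is defined by Albanese functoriality `N_f ∘ α_c = α_{f(c)} ∘ f`.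

WHAT IS PROVED (the DEF-FREE reading of `p^*` for a Galois cover `p : X → Y = X/Δ` used by the named fact
`Jacobian.galoisCover_pullback_isWeilPairingAdjoint_norm` (`Motives/JacobianGaloisCoverNormAdjoint`): `t = p^*` is pinned by
`Nm_p ≫ t = Σ_{δ ∈ Δ} δ_*`; this file supplies the two algebraic consequences every consumer needs, WITHOUT any fact):

* `pushforward_act_comp_pushforward` — deck invariance `δ ≫ p = p` gives `δ_* ≫ Nm_p = Nm_p`; `sum_pushforward_act_comp_pushforward` —
  `(Σ_δ δ_*) ≫ Nm_p = |Δ| • Nm_p`.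
* `eq_of_pushforward_comp_eq` — **`Nm_p` is an epimorphism onto abelian varieties**: `Nm_p ≫ a = Nm_p ≫ b → a = b`, from the
  quotient property of `p` (uniqueness of factorisations into SEPARATED targets, `IsSepQuotient`), Lange's square
  `N_f ∘ α_P = α_{f(P)} ∘ f` (★ `abelJacobi_comp_pushforward`) and «`α(C)` generates `J`» (★ `hom_ext_abelJacobi`) — needs one rational
  point of `X` (automatic over an algebraically closed field: `_of_isSmoothProjective`); hence `t` is UNIQUE (`eq_of_pushforward_comp_eq_sum`).
* **`comp_pushforward_eq_card_zsmul`** — «`Nm_f ∘ f^* = d_J`»: if `Nm_p ≫ t = Σ_δ δ_*` then `t ≫ Nm_p = |Δ| • 𝟙_{J_Y}`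
  (`Nm_p ≫ t ≫ Nm_p = (Σ δ_*) ≫ Nm_p = |Δ| • Nm_p`, then cancel `Nm_p`).

Consumer (cell `hodgecm-mathlib`, D-0151, crux HLiu418 = stmt-HodgeConjecture-24832, road (P) of the d6 line's `SocketRosZ`, director
ruling s211): the compatible system of canonical-polarisation Weil pairings on an Albanese tower ((T2)) uses the adjointness FACT together
with `t ≫ Nm_p = |Δ|` (this file) to see the level forms scale by the degree.  Count-neutral; HC_CM is proved only modulo the 7 printed
citations until rung 0 closes.

## References
* [LangeRodriguez2022] H. Lange, R. E. Rodríguez, *Decomposition of Jacobians by Prym Varieties*, LNM 2310 (2022): §3.2.1 pp. 46–47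
  («`Nm_f ∘ f^* = d_J`»); §3.5.1 p. 65 Prop. 3.5.1 («`Nm_G = f^* ∘ Nm_f`»)  (printed pagination; held text chunks p0055 / p0067).
* [Lange2023AbelianVarietiesComplex] H. Lange, *Abelian Varieties over the Complex Numbers* (2023): §4.5.2 (the norm map `N_f`,
  `N_f ∘ α_c = α_{f(c)} ∘ f`), Thm. 4.5.1 (universal property).
* [MumfordAV1970] D. Mumford, *Abelian Varieties* (1970): §7 Thm. p. 66 and Remark (categorical quotients by finite groups).
-/

noncomputable section

universe u v

open CategoryTheory AlgebraicGeometry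

namespace Literature.AlgebraicGeometry.Motives

namespace Jacobian

variable {k : Type u} [Field k] {X Y : SchemeOver k} (𝒥X : Jacobian X) (𝒥Y : Jacobian Y)
  {Δ : Type v} (act : Δ → (X ≅ X)) (p : X ⟶ Y)

/-! ## §1 Deck transformations and the norm: `δ_* ≫ Nm_p = Nm_p`, `(Σ_δ δ_*) ≫ Nm_p = |Δ| • Nm_p` -/

/-- **`δ_* ≫ Nm_p = Nm_p`** for a deck transformation `δ` of `p` (`δ ≫ p = p`): functoriality of the norm map
(`(δ ≫ p)_* = δ_* ≫ p_*`). [cite: LangeRodriguez2022, §3.5.1 Prop. 3.5.1 (p. 65, proof)]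
[cite: Lange2023AbelianVarietiesComplex, §4.5.2 (the norm map N_f)] -/
theorem pushforward_act_comp_pushforward (δ : Δ) (hδ : (act δ).hom ≫ p = p) :
    𝒥X.pushforward 𝒥X (act δ).hom ≫ 𝒥X.pushforward 𝒥Y p = 𝒥X.pushforward 𝒥Y p := by
  rw [← pushforward_comp, hδ]

/-- **`(Σ_{δ ∈ Δ} δ_*) ≫ Nm_p = |Δ| • Nm_p`** for a finite family of deck transformations (LR22 Prop. 3.5.1 read after composing
with `Nm_f`: `Nm_f ∘ Nm_G = Nm_f ∘ f^* ∘ Nm_f = d · Nm_f`). [cite: LangeRodriguez2022, §3.5.1 Prop. 3.5.1 (p. 65) and §3.2.1 (pp. 46–47, Nm_f ∘ f^* = d_J)] -/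
theorem sum_pushforward_act_comp_pushforward [Fintype Δ] (hact : ∀ δ : Δ, (act δ).hom ≫ p = p) :
    (∑ δ : Δ, 𝒥X.pushforward 𝒥X (act δ).hom) ≫ 𝒥X.pushforward 𝒥Y p =
      (Fintype.card Δ : ℤ) • 𝒥X.pushforward 𝒥Y p := by
  rw [Preadditive.sum_comp]
  simp_rw [𝒥X.pushforward_act_comp_pushforward 𝒥Y act p _ (hact _)]
  rw [Finset.sum_const, Finset.card_univ, natCast_zsmul]

/-! ## §2 `Nm_p` is an epimorphism for a quotient map `p` (right-cancellation against homomorphisms of abelian varieties) -/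

/-- **Right-cancellation of the norm map of a quotient**: if `p : X → Y` is a categorical quotient for separated test objects
(`IsSepQuotient act p`) and `X` has a rational point, then `Nm_p ≫ a = Nm_p ≫ b` implies `a = b` for homomorphisms
`a b : J_Y ⟶ A` to any abelian variety.  Proof: by Lange's square `N_p ∘ α_{P₀} = α_{p P₀} ∘ p` both `α_{pP₀} ≫ a` and
`α_{pP₀} ≫ b` factor the same `Δ`-invariant morphism `X → A` through `p`, so they agree (uniqueness in `IsSepQuotient`, `A`
being separated), and `α_{pP₀}(Y)` generates `J_Y` (★ `hom_ext_abelJacobi`). [cite: Lange2023AbelianVarietiesComplex, §4.5.2 (N_f ∘ α_c = α_{f(c)} ∘ f, p. 227) and Thm. 4.5.1]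
[cite: MumfordAV1970, §7 Thm. p. 66 (Remark: categorical quotient)] -/
theorem eq_of_pushforward_comp_eq (hp : IsSepQuotient act p) (P₀ : AlgPoints X k) {A : AbelianVariety k}
    {a b : 𝒥Y.J ⟶ A} (h : 𝒥X.pushforward 𝒥Y p ≫ a = 𝒥X.pushforward 𝒥Y p ≫ b) : a = b := by
  apply hom_ext_abelJacobi (P₀ ≫ p)
  -- the invariant morphism `X → A` that both sides factor
  have hsep : IsSeparated A.X.hom := inferInstance
  have hinv : ∀ δ : Δ, (act δ).hom ≫ (p ≫ 𝒥Y.abelJacobi (P₀ ≫ p) ≫ a.hom.hom.hom) =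
      p ≫ 𝒥Y.abelJacobi (P₀ ≫ p) ≫ a.hom.hom.hom := fun δ => by
    rw [← Category.assoc, hp.1 δ]
  obtain ⟨fbar, -, huniq⟩ := hp.2 A.X (p ≫ 𝒥Y.abelJacobi (P₀ ≫ p) ≫ a.hom.hom.hom) hsep hinv
  have ha : 𝒥Y.abelJacobi (P₀ ≫ p) ≫ a.hom.hom.hom = fbar := huniq _ rfl
  -- `p ≫ α ≫ b = α_X ≫ Nm ≫ b = α_X ≫ Nm ≫ a = p ≫ α ≫ a`
  have ea : 𝒥X.abelJacobi P₀ ≫ (𝒥X.pushforward 𝒥Y p ≫ a).hom.hom.hom =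
      p ≫ 𝒥Y.abelJacobi (P₀ ≫ p) ≫ a.hom.hom.hom := by
    change 𝒥X.abelJacobi P₀ ≫ (𝒥X.pushforward 𝒥Y p).hom.hom.hom ≫ a.hom.hom.hom = _
    rw [← Category.assoc, abelJacobi_comp_pushforward, Category.assoc]
  have eb : 𝒥X.abelJacobi P₀ ≫ (𝒥X.pushforward 𝒥Y p ≫ b).hom.hom.hom =
      p ≫ 𝒥Y.abelJacobi (P₀ ≫ p) ≫ b.hom.hom.hom := by
    change 𝒥X.abelJacobi P₀ ≫ (𝒥X.pushforward 𝒥Y p).hom.hom.hom ≫ b.hom.hom.hom = _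
    rw [← Category.assoc, abelJacobi_comp_pushforward, Category.assoc]
  have hab : 𝒥X.abelJacobi P₀ ≫ (𝒥X.pushforward 𝒥Y p ≫ a).hom.hom.hom =
      𝒥X.abelJacobi P₀ ≫ (𝒥X.pushforward 𝒥Y p ≫ b).hom.hom.hom :=
    congrArg (fun u : 𝒥X.J ⟶ A => 𝒥X.abelJacobi P₀ ≫ u.hom.hom.hom) h
  have hb : 𝒥Y.abelJacobi (P₀ ≫ p) ≫ b.hom.hom.hom = fbar :=
    huniq _ (show p ≫ 𝒥Y.abelJacobi (P₀ ≫ p) ≫ b.hom.hom.hom = p ≫ 𝒥Y.abelJacobi (P₀ ≫ p) ≫ a.hom.hom.hom from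
      eb.symm.trans (hab.symm.trans ea))
  rw [ha, hb]

/-- The same over an algebraically closed field, for a smooth projective (geometrically irreducible) `X` — a rational point
exists (★ `IsSmoothProjective.nonempty_algPoints`). [cite: Lange2023AbelianVarietiesComplex, §4.5.2 and Thm. 4.5.1] -/
theorem eq_of_pushforward_comp_eq_of_isSmoothProjective [IsAlgClosed k] {n : ℕ} (hX : IsSmoothProjective n X)
    (hp : IsSepQuotient act p) {A : AbelianVariety k} {a b : 𝒥Y.J ⟶ A}
    (h : 𝒥X.pushforward 𝒥Y p ≫ a = 𝒥X.pushforward 𝒥Y p ≫ b) : a = b := by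
  obtain ⟨P₀⟩ := hX.nonempty_algPoints k
  exact 𝒥X.eq_of_pushforward_comp_eq 𝒥Y act p hp P₀ h

/-- **Uniqueness of `p^*` in its def-free form**: at most one `t : J_Y ⟶ J_X` satisfies `Nm_p ≫ t = Σ_δ δ_*` (indeed any
prescribed value), since `Nm_p` is right-cancellable. [cite: LangeRodriguez2022, §3.5.1 Prop. 3.5.1 (p. 65)] -/
theorem eq_of_pushforward_comp_eq_sum [Fintype Δ] (hp : IsSepQuotient act p) (P₀ : AlgPoints X k) {t t' : 𝒥Y.J ⟶ 𝒥X.J}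
    (ht : 𝒥X.pushforward 𝒥Y p ≫ t = ∑ δ : Δ, 𝒥X.pushforward 𝒥X (act δ).hom)
    (ht' : 𝒥X.pushforward 𝒥Y p ≫ t' = ∑ δ : Δ, 𝒥X.pushforward 𝒥X (act δ).hom) : t = t' :=
  𝒥X.eq_of_pushforward_comp_eq 𝒥Y act p hp P₀ (ht.trans ht'.symm)

/-! ## §3 «`Nm_f ∘ f^* = d_J`»: `t ≫ Nm_p = |Δ| • 𝟙` -/

/-- **`Nm_p ∘ p^* = |Δ|` in the def-free currency**: if `p : X → Y` is a quotient by the finite family `act` (`IsSepQuotient`), `X`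
has a rational point, and `t : J_Y ⟶ J_X` satisfies `Nm_p ≫ t = Σ_{δ ∈ Δ} δ_*` (LR22 Prop. 3.5.1: `t = p^*`), then
`t ≫ Nm_p = |Δ| • 𝟙_{J_Y}` (LR22 pp. 46–47 «`Nm_f ∘ f^* = d_J`», `d = |Δ|`).  Proof: `Nm_p ≫ (t ≫ Nm_p) = (Σ δ_*) ≫ Nm_p = |Δ| • Nm_p
= Nm_p ≫ (|Δ| • 𝟙)` and `Nm_p` is right-cancellable (§2). [cite: LangeRodriguez2022, §3.2.1 (pp. 46–47, Nm_f ∘ f^* = d_J) and §3.5.1 Prop. 3.5.1 (p. 65)] -/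
theorem comp_pushforward_eq_card_zsmul [Fintype Δ] (hp : IsSepQuotient act p) (P₀ : AlgPoints X k) (t : 𝒥Y.J ⟶ 𝒥X.J)
    (ht : 𝒥X.pushforward 𝒥Y p ≫ t = ∑ δ : Δ, 𝒥X.pushforward 𝒥X (act δ).hom) :
    t ≫ 𝒥X.pushforward 𝒥Y p = (Fintype.card Δ : ℤ) • 𝟙 𝒥Y.J := by
  refine 𝒥X.eq_of_pushforward_comp_eq 𝒥Y act p hp P₀ ?_
  rw [← Category.assoc, ht, 𝒥X.sum_pushforward_act_comp_pushforward 𝒥Y act p hp.1, Preadditive.comp_zsmul,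
    Category.comp_id]

/-- The same over an algebraically closed field for a smooth projective `X` (the rational point is automatic).
[cite: LangeRodriguez2022, §3.2.1 (pp. 46–47, Nm_f ∘ f^* = d_J) and §3.5.1 Prop. 3.5.1 (p. 65)] -/
theorem comp_pushforward_eq_card_zsmul_of_isSmoothProjective [IsAlgClosed k] {n : ℕ} [Fintype Δ]
    (hX : IsSmoothProjective n X) (hp : IsSepQuotient act p) (t : 𝒥Y.J ⟶ 𝒥X.J)
    (ht : 𝒥X.pushforward 𝒥Y p ≫ t = ∑ δ : Δ, 𝒥X.pushforward 𝒥X (act δ).hom) :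
    t ≫ 𝒥X.pushforward 𝒥Y p = (Fintype.card Δ : ℤ) • 𝟙 𝒥Y.J := by
  obtain ⟨P₀⟩ := hX.nonempty_algPoints k
  exact 𝒥X.comp_pushforward_eq_card_zsmul 𝒥Y act p hp P₀ t ht

/-- **Consequently `Nm_p ≫ t ≫ Nm_p ≫ t = |Δ| • (Nm_p ≫ t)`**, i.e. `Nm_Δ ∘ Nm_Δ = |Δ| · Nm_Δ` on `J_X` read through `t`
(the norm endomorphism of the Galois group is `|Δ|` times an idempotent). [cite: LangeRodriguez2022, §3.5.1 Prop. 3.5.1 and Cor. 3.5.2 (p. 65)] -/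
theorem pushforward_comp_comp_pushforward_comp_eq_card_zsmul [Fintype Δ] (hp : IsSepQuotient act p) (P₀ : AlgPoints X k)
    (t : 𝒥Y.J ⟶ 𝒥X.J) (ht : 𝒥X.pushforward 𝒥Y p ≫ t = ∑ δ : Δ, 𝒥X.pushforward 𝒥X (act δ).hom) :
    𝒥X.pushforward 𝒥Y p ≫ t ≫ 𝒥X.pushforward 𝒥Y p ≫ t = (Fintype.card Δ : ℤ) • (𝒥X.pushforward 𝒥Y p ≫ t) := by
  rw [← Category.assoc t (𝒥X.pushforward 𝒥Y p) t, 𝒥X.comp_pushforward_eq_card_zsmul 𝒥Y act p hp P₀ t ht,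
    Preadditive.zsmul_comp, Category.id_comp, Preadditive.comp_zsmul]

end Jacobian

end Literature.AlgebraicGeometry.Motives

end
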